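import Summits.BirchSwinnertonDyer.BirchSwinnertonDyer.Theorems.ResidualThetaTransportAtTwoResidualThetaMainConjectureAtTwoMazurTateLayer
import Literature.NumberTheory.EllipticCurves.PAdicBSDSkinnerUrbanProofs
import Literature.NumberTheory.QuadraticForms.HilbertReciprocityRat
import Mathlib.RingTheory.PowerSeries.WeierstrassPreparation
import HarnessLib

/-!
# Crux `MazurTateCongruenceAtTwoR` (stmt-BirchSwinnertonDyer-21416 = stub `stub_V2mtR` of K1 20333, line `bridge`):
# INTEGRALITY TRANSFER through a Pollack congruence, and the Λ-to-layer direction of the congruence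

Cell `bsd-wall`, seat `bsd-wall-tp2-p1-w2` (WIDTH seat on K1 `SignedTransportAtTwo`). THEOREMS ONLY (no `def`, no
named fact, no `sorry`); pure algebra of `Λ = ℤ_p⟦T⟧` at EVERY prime `p` (Mathlib's Weierstrass division over the
complete local ring `ℤ_p`, `PowerSeries.IsWeierstrassDivision`).

THE POINT. The crux `MazurTateCongruenceAtTwoR` (and Kobayashi's main conjecture at `2`, `KobayashiMainConjecture W 2 ε`)
quantify over a Pollack pair `(L⁺, L⁻) ∈ Λ²` of the newform `f` (`θ_n(f) ≡ ω·L (mod ω_n)` in `Λ ⊗ ℚ_p`, tree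
`IsCongrModOmega p n θ ω L`: `p^{m₁}(θ − ω L) = ω_n q₁` with `q₁ ∈ Λ`) and over an "integral multiple"
`G ∈ Λ`, `ι G = c · ι L` (`c = 2^m ϖ`). We prove (`exists_coe_eq_C_mul_of_isCongrModOmega`):

* `c · θ` IS INTEGRAL: `c · θ = ι R` for a polynomial `R ∈ ℤ_p[X]` of degree `< pⁿ` — namely the Weierstrass
  remainder of `ω·G` modulo the distinguished polynomial `ω_n = (1+T)^{pⁿ} − 1` — and
* the congruence quotient is INTEGRAL: `R = ω·G + ω_n·ρ` with `ρ ∈ Λ` (not merely in `Λ[1/p]`).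

(Proof: `p^{m₁}(cθ − R) = ω_n · Y` in `ℚ_p⟦T⟧` with `Y ∈ Λ[1/p]`; clearing denominators, a polynomial of degree
`< pⁿ = ord_T(ω_n mod p)` divisible by `ω_n` in `Λ` vanishes — uniqueness of Weierstrass division,
`PowerSeries.IsWeierstrassDivisorAt.eq_zero_of_mul_eq`.) CONSEQUENCE (`exists_layer_congruence_of_lambda_congruence`):
a congruence IN `Λ` between two such integral multiples, `a·G·E − b·G'·E' ∈ p^k Λ`, descends to EVERY layer:
`a·(cθ)·E − b·(c'θ')·E' ∈ (p^k, ω_n)Λ` — the shape of the conclusion of `MazurTateCongruenceAtTwoR`. In particular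
all admissible `(G, m)` of that crux give EQUIVALENT instances (the vet's open point, item 21416 note
2026-08-27T20:32Z: integrality of `2^{m+m'}(ϖθ_n E_W − u ϖ_A θ_n^A E_A)` is AUTOMATIC).

References: R. Pollack, Duke Math. J. 118 (2003) Prop. 6.18 [Pollack2003]; R. Greenberg, V. Vatsal, Invent. Math.
142 (2000) §3, (13) [GreenbergVatsal2000]; L. Washington, GTM 83, Prop. 7.2 [Washington1997].
-/

set_option linter.dupNamespace false
set_option autoImplicit false

noncomputable section

open scoped Classical

open Polynomial Literature.NumberTheory.EllipticCurves Summit.BirchSwinnertonDyer.Rank1Residual.X1.MuLambda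
  Summit.BirchSwinnertonDyer.Rank1Residual.X2.GreenbergVatsalAnalyticTransferCore
  Summit.BirchSwinnertonDyer.BirchSwinnertonDyer.Theorems.ResidualThetaLayer

namespace Summit.BirchSwinnertonDyer.BirchSwinnertonDyer.Theorems.MazurTateCongruenceAtTwoR

section Omega

variable {p : ℕ} [hp : Fact p.Prime]

/-- `ord_T(ω_n mod 𝔪) = pⁿ` for `ω_n = (1+T)^{pⁿ} − 1 ∈ Λ = ℤ_p⟦T⟧` (`ω_n ≡ T^{pⁿ} (mod p)`).
[cite: Washington1997, §7.1] -/
theorem order_map_residue_cyclotomicOmega (n : ℕ) :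
    (PowerSeries.map (IsLocalRing.residue ℤ_[p])
        (((cyclotomicOmega p n).map (Int.castRingHom ℤ_[p]) : ℤ_[p][X]) : PowerSeries ℤ_[p])).order =
      ((p ^ n : ℕ) : ℕ∞) := by
  have h := order_map_toZMod_eq_order_red
    ((((cyclotomicOmega p n).map (Int.castRingHom ℤ_[p]) : ℤ_[p][X]) : PowerSeries ℤ_[p]))
  rw [map_toZMod_cyclotomicOmega, PowerSeries.order_X_pow] at h
  exact h.symm

/-- `ω_n mod 𝔪 ≠ 0` in `𝔽_p⟦T⟧`. [cite: Washington1997, §7.1] -/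
theorem map_residue_cyclotomicOmega_ne_zero (n : ℕ) :
    PowerSeries.map (IsLocalRing.residue ℤ_[p])
        (((cyclotomicOmega p n).map (Int.castRingHom ℤ_[p]) : ℤ_[p][X]) : PowerSeries ℤ_[p]) ≠ 0 := by
  intro h
  have h1 := order_map_residue_cyclotomicOmega (p := p) n
  rw [h, PowerSeries.order_zero] at h1
  exact ENat.top_ne_coe _ h1

/-- The Weierstrass order of `ω_n` (the bound on remainder degrees in Mathlib's Weierstrass division) is `pⁿ`.
[cite: Washington1997, Prop. 7.2] -/
theorem toNat_order_map_cyclotomicOmega (n : ℕ) :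
    (PowerSeries.map (Ideal.Quotient.mk (IsLocalRing.maximalIdeal ℤ_[p]))
        (((cyclotomicOmega p n).map (Int.castRingHom ℤ_[p]) : ℤ_[p][X]) : PowerSeries ℤ_[p])).order.toNat =
      p ^ n := by
  have h : (PowerSeries.map (Ideal.Quotient.mk (IsLocalRing.maximalIdeal ℤ_[p]))
      (((cyclotomicOmega p n).map (Int.castRingHom ℤ_[p]) : ℤ_[p][X]) : PowerSeries ℤ_[p])).order =
      ((p ^ n : ℕ) : ℕ∞) :=
    order_map_residue_cyclotomicOmega n
  rw [h, ENat.toNat_coe]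

/-- **Uniqueness of Weierstrass division by `ω_n`**: if `ω_n · q` is a polynomial of degree `< pⁿ` (`q ∈ Λ`),
then `q = 0` and the polynomial is `0`. [cite: Washington1997, Prop. 7.2] -/
theorem eq_zero_of_cyclotomicOmega_mul_eq_coe {n : ℕ} {q : IwasawaAlgebra p} {r : ℤ_[p][X]}
    (hr : r.degree < ((p ^ n : ℕ) : WithBot ℕ))
    (h : (((cyclotomicOmega p n).map (Int.castRingHom ℤ_[p]) : ℤ_[p][X]) : PowerSeries ℤ_[p]) * q = r) :
    q = 0 ∧ r = 0 := by
  have H := PowerSeries.IsWeierstrassDivisor.of_map_ne_zero (map_residue_cyclotomicOmega_ne_zero (p := p) n)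
  refine H.eq_zero_of_mul_eq ?_ h
  rw [toNat_order_map_cyclotomicOmega]
  exact hr

/-- **Weierstrass division by `ω_n` in `Λ`**: every `f ∈ Λ` is `ω_n · s + R` with `R ∈ ℤ_p[X]` of degree `< pⁿ`.
[cite: Washington1997, Prop. 7.2] -/
theorem exists_eq_cyclotomicOmega_mul_add_coe (n : ℕ) (f : IwasawaAlgebra p) :
    ∃ (s : IwasawaAlgebra p) (R : ℤ_[p][X]), R.degree < ((p ^ n : ℕ) : WithBot ℕ) ∧
      f = (((cyclotomicOmega p n).map (Int.castRingHom ℤ_[p]) : ℤ_[p][X]) : PowerSeries ℤ_[p]) * s + R := by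
  obtain ⟨s, R, hR⟩ :=
    PowerSeries.exists_isWeierstrassDivision f (map_residue_cyclotomicOmega_ne_zero (p := p) n)
  refine ⟨s, R, ?_, hR.eq_mul_add⟩
  have h := hR.degree_lt
  rw [toNat_order_map_cyclotomicOmega] at h
  exact h

end Omega

section Integrality

variable {p : ℕ} [hp : Fact p.Prime]

/-- Every polynomial over `ℚ_p` becomes integral after multiplication by a power of `p`:
`p^j · Q = ι D₀` with `D₀ ∈ Λ` (`Λ ⊗ ℚ_p ⊇ ℚ_p[X]`). [folklore] -/
theorem exists_C_pow_mul_coe_eq_iwasawaToPowerSeries (Q : ℚ_[p][X]) :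
    ∃ (j : ℕ) (D₀ : IwasawaAlgebra p),
      PowerSeries.C ((p : ℚ_[p]) ^ j) * (Q : PowerSeries ℚ_[p]) = iwasawaToPowerSeries p D₀ := by
  induction Q using Polynomial.induction_on' with
  | add P Q hP hQ =>
    obtain ⟨j₁, D₁, h₁⟩ := hP
    obtain ⟨j₂, D₂, h₂⟩ := hQ
    refine ⟨j₁ + j₂, PowerSeries.C ((p : ℤ_[p]) ^ j₂) * D₁ + PowerSeries.C ((p : ℤ_[p]) ^ j₁) * D₂, ?_⟩
    rw [Polynomial.coe_add, mul_add, map_add, map_mul, map_mul, iwasawaToPowerSeries_C_natCast_pow,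
      iwasawaToPowerSeries_C_natCast_pow, ← h₁, ← h₂, pow_add, map_mul]
    ring
  | monomial k a =>
    obtain ⟨j, y, hy⟩ := Literature.NumberTheory.QuadraticForms.Dyadic.exists_pow_mul_mem_padicInt a
    refine ⟨j, PowerSeries.monomial k y, ?_⟩
    ext i
    simp only [PowerSeries.coeff_C_mul, Polynomial.coeff_coe, Polynomial.coeff_monomial, PowerSeries.coeff_map,
      PowerSeries.coeff_monomial]
    by_cases hi : i = k
    · subst hi
      rw [if_pos rfl, if_pos rfl, show (algebraMap ℤ_[p] ℚ_[p]) y = (y : ℚ_[p]) from rfl, hy]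
    · rw [if_neg (Ne.symm hi), if_neg hi, mul_zero, map_zero]

/-- **Integrality transfer through a Pollack congruence.** Let `θ ∈ ℚ[X]` of degree `< pⁿ` satisfy
`θ ≡ ω · L (mod ω_n)` in `Λ ⊗ ℚ_p` (`IsCongrModOmega p n θ ω L`, e.g. Pollack 2003 Prop. 6.18 for `θ_n(f)`), and
let `G ∈ Λ` with `ι G = c · ι L` (`c ∈ ℚ_p`; "`c · L` is integral"). Then `c · θ` is integral — `c · θ = ι R` for the
Weierstrass remainder `R ∈ ℤ_p[X]` (degree `< pⁿ`) of `ω · G` modulo `ω_n` — and the quotient is integral: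
`R = ω · G + ω_n · ρ` with `ρ ∈ Λ`. [cite: Pollack2003, Prop. 6.18] [cite: Washington1997, Prop. 7.2] -/
theorem exists_coe_eq_C_mul_of_isCongrModOmega {n : ℕ} {θ : ℚ[X]} {ω : ℤ[X]} {L G : IwasawaAlgebra p}
    {c : ℚ_[p]} (hθ : IsCongrModOmega p n θ ω L) (hdeg : θ.natDegree < p ^ n)
    (hG : iwasawaToPowerSeries p G = PowerSeries.C c * iwasawaToPowerSeries p L) :
    ∃ (R : ℤ_[p][X]) (ρ : IwasawaAlgebra p), R.degree < ((p ^ n : ℕ) : WithBot ℕ) ∧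
      PowerSeries.C c * ((θ.map (algebraMap ℚ ℚ_[p]) : ℚ_[p][X]) : PowerSeries ℚ_[p]) =
        iwasawaToPowerSeries p (R : PowerSeries ℤ_[p]) ∧
      (R : PowerSeries ℤ_[p]) =
        ((ω.map (Int.castRingHom ℤ_[p]) : ℤ_[p][X]) : PowerSeries ℤ_[p]) * G +
          (((cyclotomicOmega p n).map (Int.castRingHom ℤ_[p]) : ℤ_[p][X]) : PowerSeries ℤ_[p]) * ρ := by
  obtain ⟨m₁, q₁, hmq⟩ := hθ
  -- notation
  set ι := iwasawaToPowerSeries p with hι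
  set ωΛ : IwasawaAlgebra p := ((ω.map (Int.castRingHom ℤ_[p]) : ℤ_[p][X]) : PowerSeries ℤ_[p]) with hωΛ
  set ωn : IwasawaAlgebra p :=
    (((cyclotomicOmega p n).map (Int.castRingHom ℤ_[p]) : ℤ_[p][X]) : PowerSeries ℤ_[p]) with hωn
  set θ' : PowerSeries ℚ_[p] := ((θ.map (algebraMap ℚ ℚ_[p]) : ℚ_[p][X]) : PowerSeries ℚ_[p]) with hθ'
  have hp0 : (p : ℤ_[p]) ≠ 0 := by exact_mod_cast hp.out.ne_zero
  have hp0' : (p : ℚ_[p]) ≠ 0 := by exact_mod_cast hp.out.ne_zero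
  have hιC : ∀ k : ℕ, ι (PowerSeries.C ((p : ℤ_[p]) ^ k)) = PowerSeries.C ((p : ℚ_[p]) ^ k) := fun k ↦ by
    rw [hι, iwasawaToPowerSeries_C_natCast_pow]
  -- Weierstrass division of `ω G` by `ω_n`
  obtain ⟨s, R, hRdeg, hdiv⟩ := exists_eq_cyclotomicOmega_mul_add_coe n (ωΛ * G)
  rw [← hωn] at hdiv
  refine ⟨R, -s, hRdeg, ?_, by rw [hdiv]; ring⟩
  -- the key identity `p^{m₁} (c θ − ι R) = ι ω_n · (c ι q₁ + p^{m₁} ι s)`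
  have h1 : PowerSeries.C ((p : ℚ_[p]) ^ m₁) * θ' =
      PowerSeries.C ((p : ℚ_[p]) ^ m₁) * (ι ωΛ * ι L) + ι ωn * ι q₁ := by
    have h := hmq
    rw [mul_sub, sub_eq_iff_eq_add, map_mul, map_mul] at h
    linear_combination h
  have hR : ι (R : PowerSeries ℤ_[p]) = ι ωΛ * (PowerSeries.C c * ι L) - ι ωn * ι s := by
    rw [← hG, ← map_mul, ← map_mul, ← map_sub]
    congr 1
    rw [hdiv]
    ring
  have hkey : PowerSeries.C ((p : ℚ_[p]) ^ m₁) * (PowerSeries.C c * θ' - ι R) =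
      ι ωn * (PowerSeries.C c * ι q₁ + PowerSeries.C ((p : ℚ_[p]) ^ m₁) * ι s) := by
    linear_combination (PowerSeries.C c) * h1 - (PowerSeries.C ((p : ℚ_[p]) ^ m₁)) * hR
  -- clearing denominators
  obtain ⟨j, y, hy⟩ := Literature.NumberTheory.QuadraticForms.Dyadic.exists_pow_mul_mem_padicInt c
  set Q : ℚ_[p][X] := Polynomial.C c * θ.map (algebraMap ℚ ℚ_[p]) - R.map (algebraMap ℤ_[p] ℚ_[p]) with hQ
  have hDQ : PowerSeries.C c * θ' - ι R = (Q : PowerSeries ℚ_[p]) := by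
    rw [hQ, Polynomial.coe_sub, Polynomial.coe_mul, Polynomial.coe_C, hθ', hι, iwasawaToPowerSeries,
      map_coe_polynomial]
  obtain ⟨j', D₀, hD₀⟩ := exists_C_pow_mul_coe_eq_iwasawaToPowerSeries Q
  -- `Y₀ = y q₁ + p^{m₁+j} s`, `ι Y₀ = p^j · (c ι q₁ + p^{m₁} ι s)`
  set Y₀ : IwasawaAlgebra p := PowerSeries.C y * q₁ + PowerSeries.C ((p : ℤ_[p]) ^ (m₁ + j)) * s with hY₀
  have hιY₀ : ι Y₀ = PowerSeries.C ((p : ℚ_[p]) ^ j) *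
      (PowerSeries.C c * ι q₁ + PowerSeries.C ((p : ℚ_[p]) ^ m₁) * ι s) := by
    rw [hY₀, map_add, map_mul, map_mul, hιC, pow_add, map_mul]
    rw [hι, iwasawaToPowerSeries, PowerSeries.map_C]
    rw [show (algebraMap ℤ_[p] ℚ_[p]) y = (y : ℚ_[p]) from rfl, hy, map_mul, map_pow]
    ring
  -- in `Λ`: `p^{m₁+j} D₀ = ω_n · (p^{j'} Y₀)`
  have hΛ : PowerSeries.C ((p : ℤ_[p]) ^ (m₁ + j)) * D₀ = ωn * (PowerSeries.C ((p : ℤ_[p]) ^ j') * Y₀) := by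
    apply iwasawaToPowerSeries_injective p
    rw [← hι, map_mul, map_mul, map_mul, hιC, hιC, ← hD₀, hιY₀, ← hDQ, pow_add, map_mul]
    linear_combination (PowerSeries.C ((p : ℚ_[p]) ^ j) * PowerSeries.C ((p : ℚ_[p]) ^ j')) * hkey
  -- `D₀` has no coefficient in degree `≥ pⁿ`
  have hQcoeff : ∀ i, p ^ n ≤ i → Q.coeff i = 0 := by
    intro i hi
    have hθi : θ.coeff i = 0 := coeff_eq_zero_of_natDegree_lt (lt_of_lt_of_le hdeg hi)
    have hRi : R.coeff i = 0 := by
      refine coeff_eq_zero_of_degree_lt (lt_of_lt_of_le hRdeg ?_)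
      exact_mod_cast hi
    rw [hQ, coeff_sub, coeff_C_mul, coeff_map, coeff_map, hθi, hRi, map_zero, map_zero, mul_zero, sub_zero]
  have hD₀coeff : ∀ i, p ^ n ≤ i → PowerSeries.coeff i D₀ = 0 := by
    intro i hi
    have h := PowerSeries.ext_iff.mp hD₀ i
    rw [PowerSeries.coeff_C_mul, Polynomial.coeff_coe, hQcoeff i hi, mul_zero, iwasawaToPowerSeries,
      PowerSeries.coeff_map] at h
    exact (IsFractionRing.injective ℤ_[p] ℚ_[p]) (by rw [← h, map_zero])
  -- so `p^{m₁+j} D₀` is a polynomial `R₁` of degree `< pⁿ`, divisible by `ω_n`: it vanishes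
  set R₁ : ℤ_[p][X] := PowerSeries.trunc (p ^ n) (PowerSeries.C ((p : ℤ_[p]) ^ (m₁ + j)) * D₀) with hR₁
  have hR₁coe : (R₁ : PowerSeries ℤ_[p]) = PowerSeries.C ((p : ℤ_[p]) ^ (m₁ + j)) * D₀ := by
    ext i
    rw [Polynomial.coeff_coe, hR₁, PowerSeries.coeff_trunc]
    split_ifs with h
    · rfl
    · rw [PowerSeries.coeff_C_mul, hD₀coeff i (not_lt.mp h), mul_zero]
  have hzero := (eq_zero_of_cyclotomicOmega_mul_eq_coe (p := p) (n := n)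
    (q := PowerSeries.C ((p : ℤ_[p]) ^ j') * Y₀) (r := R₁)
    (by exact_mod_cast PowerSeries.degree_trunc_lt _ _) (by rw [hR₁coe, ← hΛ])).2
  have hD₀zero : D₀ = 0 := by
    have h : PowerSeries.C ((p : ℤ_[p]) ^ (m₁ + j)) * D₀ = 0 := by rw [← hR₁coe, hzero, Polynomial.coe_zero]
    exact (mul_eq_zero.mp h).resolve_left (C_pow_ne_zero _)
  have hQzero : (Q : PowerSeries ℚ_[p]) = 0 := by
    have h : PowerSeries.C ((p : ℚ_[p]) ^ j') * (Q : PowerSeries ℚ_[p]) = 0 := by rw [hD₀, hD₀zero, map_zero]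
    refine (mul_eq_zero.mp h).resolve_left ?_
    intro h0
    apply pow_ne_zero j' hp0'
    have h0' := congr_arg (fun φ ↦ PowerSeries.coeff 0 φ) h0
    simpa using h0'
  exact sub_eq_zero.mp (hDQ.trans hQzero)

end Integrality

section LayerOfLambda

variable {p : ℕ} [hp : Fact p.Prime]

/-- **A congruence in `Λ` descends to every layer.** In the setting of the integrality transfer for TWO congruences
with the SAME `ω` (`θ ≡ ω L`, `θ' ≡ ω L' (mod ω_n)`, degrees `< pⁿ`, integral multiples `ι G = c ι L`,
`ι G' = c' ι L'`), a congruence `a·G·E − b·G'·E' ∈ p^k Λ` between the integral multiples gives, at layer `n`,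
`a·(c θ)·E − b·(c' θ')·E' ∈ ι((p^k, ω_n)Λ)` — with `c = 2^m ϖ`, `c' = 2^{m'} ϖ_A`, `a = 2^{m'}`, `b = u 2^m`,
`k = m + m' + 1`, `ω = ±ω_n^-`, `E, E'` the depleting Euler factors, this is exactly the conclusion of the crux
`MazurTateCongruenceAtTwoR` at the even layer `n` (Greenberg–Vatsal 2000 §3: congruent `p`-adic `L`-functions have
congruent Mazur–Tate elements). [cite: GreenbergVatsal2000, §3, (13)] [cite: Pollack2003, Prop. 6.18] -/
theorem exists_layer_congruence_of_lambda_congruence {n : ℕ} {θ θ' : ℚ[X]} {ω : ℤ[X]}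
    {L L' G G' E E' q₀ : IwasawaAlgebra p} {c c' : ℚ_[p]} {a b : ℤ_[p]} {k : ℕ}
    (hθ : IsCongrModOmega p n θ ω L) (hθ' : IsCongrModOmega p n θ' ω L')
    (hdeg : θ.natDegree < p ^ n) (hdeg' : θ'.natDegree < p ^ n)
    (hG : iwasawaToPowerSeries p G = PowerSeries.C c * iwasawaToPowerSeries p L)
    (hG' : iwasawaToPowerSeries p G' = PowerSeries.C c' * iwasawaToPowerSeries p L')
    (hΛ : PowerSeries.C a * G * E - PowerSeries.C b * G' * E' = PowerSeries.C ((p : ℤ_[p]) ^ k) * q₀) :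
    ∃ q r : IwasawaAlgebra p,
      PowerSeries.C (a : ℚ_[p]) *
            (PowerSeries.C c * ((θ.map (algebraMap ℚ ℚ_[p]) : ℚ_[p][X]) : PowerSeries ℚ_[p]) *
              iwasawaToPowerSeries p E) -
          PowerSeries.C (b : ℚ_[p]) *
            (PowerSeries.C c' * ((θ'.map (algebraMap ℚ ℚ_[p]) : ℚ_[p][X]) : PowerSeries ℚ_[p]) *
              iwasawaToPowerSeries p E') =
        iwasawaToPowerSeries p (PowerSeries.C ((p : ℤ_[p]) ^ k) * q +
          (((cyclotomicOmega p n).map (Int.castRingHom ℤ_[p]) : ℤ_[p][X]) : PowerSeries ℤ_[p]) * r) := by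
  obtain ⟨R, ρ, -, hR, hRρ⟩ := exists_coe_eq_C_mul_of_isCongrModOmega hθ hdeg hG
  obtain ⟨R', ρ', -, hR', hRρ'⟩ := exists_coe_eq_C_mul_of_isCongrModOmega hθ' hdeg' hG'
  set ι := iwasawaToPowerSeries p with hι
  set ωΛ : IwasawaAlgebra p := ((ω.map (Int.castRingHom ℤ_[p]) : ℤ_[p][X]) : PowerSeries ℤ_[p]) with hωΛ
  set ωn : IwasawaAlgebra p :=
    (((cyclotomicOmega p n).map (Int.castRingHom ℤ_[p]) : ℤ_[p][X]) : PowerSeries ℤ_[p]) with hωn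
  refine ⟨ωΛ * q₀, PowerSeries.C a * ρ * E - PowerSeries.C b * ρ' * E', ?_⟩
  have hCa : PowerSeries.C (a : ℚ_[p]) = ι (PowerSeries.C a) := by
    rw [hι, iwasawaToPowerSeries, PowerSeries.map_C]; rfl
  have hCb : PowerSeries.C (b : ℚ_[p]) = ι (PowerSeries.C b) := by
    rw [hι, iwasawaToPowerSeries, PowerSeries.map_C]; rfl
  rw [hR, hR', hRρ, hRρ', hCa, hCb]
  simp only [← map_mul, ← map_sub]
  congr 1
  linear_combination ωΛ * hΛ

end LayerOfLambda

end Summit.BirchSwinnertonDyer.BirchSwinnertonDyer.Theorems.MazurTateCongruenceAtTwoR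

end
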